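import Literature.NumberTheory.NumberFields.RayClassTowerGlobalUnits
import Literature.NumberTheory.NumberFields.RayClassFieldAdicTowerRefine
import Mathlib.RingTheory.Norm.Transitivity
import HarnessLib

/-!
# The relative norm `N_{𝔣′,𝔣}` of norm-coherent sequences of GLOBAL units along `K(𝔣′v^{m+1}) ⊇ K(𝔣v^{m+1})`
# (de Shalit 1987, III.1.2 (ii): "`N_{𝔤,𝔣}` is the norm from `K(𝔤𝔭^∞)` to `K(𝔣𝔭^∞)`"), and `N_{𝔣′,𝔣} = ∏_{τ ∈ T} τ` for a
# transversal `T ⊆ Gal(K̄/K(𝔣v^∞))` of `Gal(K(𝔣′)/K(𝔣))`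

Topic `NumberTheory/NumberFields`; namespace `Literature.NumberTheory.NumberFields`.

De Shalit III.1.2 Lemma (ii) (p. 89): for `𝔣 ∣ 𝔤` the left square `π_{𝔤,𝔣} ∘ i(𝔤) = i(𝔣) ∘ N_{𝔤,𝔣}` with "`N_{𝔤,𝔣}` the norm from
`K(𝔤𝔭^∞)` to `K(𝔣𝔭^∞)`"; II.4.14 Step 1 (p. 71): the compatibility of the `μ(𝔤𝔭̄^m)`; II.2.5 (i) (p. 47): the norm relation of
the elliptic units.  `RayClassTowerGlobalUnits.lean` packaged the global norm-coherent unit sequences `GlobalNormCoherentUnits h𝔣 v`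
(`x_m ∈ K(𝔣v^{m+1})`) with their `Γ_K`-action; THIS file supplies the map between two moduli `0 ≠ 𝔣′ ⊆ 𝔣`:

* §1 `GlobalNormCoherentUnits.relNorm : GlobalNormCoherentUnits h𝔣′ v → GlobalNormCoherentUnits h𝔣 v` —
  **`(N b′)_m = N_{K(𝔣′v^{m+1})/K(𝔣v^{m+1})} b′_m`** (Mathlib's `Algebra.norm` for the inclusion); a unit again (a product of
  `Γ_K`-conjugates of a unit), norm-coherent by TRANSITIVITY OF NORMS along the two towers (`N ∘ N = N`, both ways round the
  square `K(𝔣v^{n+1}) ⊆ K(𝔣v^{m+1}), K(𝔣′v^{n+1}) ⊆ K(𝔣′v^{m+1})` — no linear-disjointness input); `coe_val_relNorm`;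
* §2 ★ `GlobalNormCoherentUnits.coe_val_finset_prod_smul_eq_relNorm` — for a transversal `T ⊆ Gal(K̄/K(𝔣v^∞))` of
  `Gal(K(𝔣′)/K(𝔣))` (`RayClassFieldAdicTowerRefine.exists_rayTransversal`; `K` totally complex, `v ∤ 𝔣′`, `w_𝔣 = 1`):
  **`(∏_{τ ∈ T} τ • b′)_m = (N b′)_m` in `K̄` for every `m`** — the product of conjugates in the `Γ_K`-monoid of modulus `𝔣′` HAS THE
  COMPONENTS of the relative norm (it is the norm, read in the bigger fields `K(𝔣′v^{m+1})`); with `γ •` in front as well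
  (`coe_val_smul_finset_prod_smul_eq`).  This is the `hN`-link consumed by
  `GroupDistribution.pushforward_induceFrom_μ_eq_induceFrom_of_norm`.

One definition with body (`relNorm`); theorems otherwise; the `CommMonoid`/`galAction` structures of the sibling file are enabled
section-locally exactly as there; no named facts, no global instances, no `sorry`.

## References
* [deShalit1987] E. de Shalit, *Iwasawa theory of elliptic curves with complex multiplication* (1987), III.1.2 Lemma (ii) (p. 89),
  II.4.14 Step 1 (p. 71), II.2.5 (i) (p. 47), II.4.9 (24) (p. 62).
* [NeukirchANT1999] J. Neukirch, *Algebraic Number Theory* (1999), Ch. I §2 (2.2)–(2.4), Ch. IV §1 (1.2).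
-/

noncomputable section

open NumberField IsDedekindDomain IsDedekindDomain.HeightOneSpectrum Field
open scoped nonZeroDivisors Classical

namespace Literature.NumberTheory.NumberFields

open Literature.NumberTheory.GaloisRepresentations

variable {K : Type} [Field K] [NumberField K] {𝔣 𝔣' : Ideal (𝓞 K)} {v : HeightOneSpectrum (𝓞 K)}

omit [NumberField K] in
/-- `((τ|_L) x : K̄) = τ • x`. [folklore] -/
private theorem coe_absRestrictNormalHom_apply₁₄ (L : IntermediateField K (AlgebraicClosure K)) [Normal K L]
    (τ : absoluteGaloisGroup K) (x : L) :
    ((absRestrictNormalHom L τ x : L) : AlgebraicClosure K) = τ • (x : AlgebraicClosure K) :=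
  AlgEquiv.restrictNormalHom_apply L _ x

omit [NumberField K] in
/-- An algebraic integer stays an algebraic integer under any ring map (ring maps commute with `ℤ`). [folklore] -/
private theorem isIntegral_int_map_ringHom₁₄ {R S : Type*} [CommRing R] [CommRing S] (f : R →+* S) {x : R}
    (hx : IsIntegral ℤ x) : IsIntegral ℤ (f x) :=
  hx.map_of_comp_eq (RingHom.id ℤ) f (RingHom.ext_int _ _)

omit [NumberField K] in
/-- Transitivity of norms in a tower `A ≤ B ≤ C` of subfields of `K̄`: `N_{B/A}(N_{C/B} x) = N_{C/A} x` — a private copy of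
`Literature.NumberTheory.GaloisRepresentations.towerNorm_towerNorm` (`LubinTateColemanRelativeBaseNormTwo.lean`, not in this file's
import closure; importing it would drag in the Lubin–Tate stack). [cite: NeukirchANT1999, Ch. I §2 (2.4)] -/
private theorem towerNorm_towerNorm₁₄ {A B C : IntermediateField K (AlgebraicClosure K)} (hAB : A ≤ B) (hBC : B ≤ C) (x : C) :
    @Algebra.norm A B _ _ (towerAlgebra hAB) (@Algebra.norm B C _ _ (towerAlgebra hBC) x) =
      @Algebra.norm A C _ _ (towerAlgebra (hAB.trans hBC)) x := by
  letI : Algebra A B := towerAlgebra hAB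
  letI : Algebra B C := towerAlgebra hBC
  letI : Algebra A C := towerAlgebra (hAB.trans hBC)
  haveI : IsScalarTower A B C := IsScalarTower.of_algebraMap_eq fun _ ↦ rfl
  exact Algebra.norm_norm

omit [NumberField K] in
/-- **The tower norm read in `K̄` is a product of `Γ_K`-translates**: for `L ≤ L′ ⊆ K̄` with `L′/K` finite Galois and `x ∈ L′`,
`ι(N_{L′/L} x) = ∏_{σ} σ̃ • x` over the automorphisms `σ` of `L′/K` fixing `L`, each realised by a lift `σ̃ ∈ Γ_K`
(`algebraMap_towerNorm_eq_prod`). [cite: NeukirchANT1999, Ch. IV §1 (1.2), Ch. I §2 (2.2)] -/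
theorem coe_towerNorm_eq_prod_smul {L L' : IntermediateField K (AlgebraicClosure K)} [FiniteDimensional K L'] [IsGalois K L']
    (h : L ≤ L') (x : L') :
    ((@Algebra.norm L L' _ _ (towerAlgebra h) x : L) : AlgebraicClosure K) =
      ∏ σ ∈ Finset.univ.filter (fun σ : L' ≃ₐ[K] L' ↦ ∀ y : L, σ (IntermediateField.inclusion h y) = IntermediateField.inclusion h y),
        Classical.choose (absRestrictNormalHom_surjective L' σ) • (x : AlgebraicClosure K) := by
  have h1 := congrArg (fun z : L' ↦ (z : AlgebraicClosure K)) (algebraMap_towerNorm_eq_prod (F := K) h x)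
  simp only [IntermediateField.coe_inclusion] at h1
  rw [h1, SubmonoidClass.coe_finsetProd]
  refine Finset.prod_congr rfl fun σ _ ↦ ?_
  conv_lhs => rw [← Classical.choose_spec (absRestrictNormalHom_surjective L' σ)]
  exact coe_absRestrictNormalHom_apply₁₄ L' _ x

namespace GlobalNormCoherentUnits

variable (h𝔣 : 𝔣 ≠ ⊥) (h𝔣' : 𝔣' ≠ ⊥)

include h𝔣' in
/-- `K(𝔣v^{m+1}) ≤ K(𝔣′v^{m+1})` for `𝔣′ ⊆ 𝔣`. [cite: NeukirchANT1999, Ch. VI §6 Def. (6.2)] -/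
theorem rayClassField_mul_pow_succ_le_of_le (hle : 𝔣' ≤ 𝔣) (m : ℕ) :
    rayClassField K (𝔣 * v.asIdeal ^ (m + 1)) ≤ rayClassField K (𝔣' * v.asIdeal ^ (m + 1)) :=
  rayClassField_le_of_le (mul_ne_zero h𝔣' (pow_ne_zero _ v.ne_bot)) (Ideal.mul_mono_left hle)

/-! ### §1. The relative norm `N_{𝔣′,𝔣}` -/

/-- ★ **The relative norm `N_{𝔣′,𝔣}` of norm-coherent sequences of global units** (de Shalit's `N_{𝔤,𝔣}`, the norm from `K(𝔤𝔭^∞)`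
to `K(𝔣𝔭^∞)`, on the global unit sequences of II.4.9 (24)): `(N b′)_m = N_{K(𝔣′v^{m+1})/K(𝔣v^{m+1})} b′_m`; non-zero algebraic
integers with algebraic-integer inverses (products of `Γ_K`-conjugates of such), norm-coherent by transitivity of norms.
[cite: deShalit1987, III.1.2 Lemma (ii) (p. 89), II.4.9 (24) (p. 62)] -/
def relNorm (hle : 𝔣' ≤ 𝔣) (b : GlobalNormCoherentUnits h𝔣' v) : GlobalNormCoherentUnits h𝔣 v where
  val m := @Algebra.norm (rayClassField K (𝔣 * v.asIdeal ^ (m + 1))) (rayClassField K (𝔣' * v.asIdeal ^ (m + 1))) _ _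
    (towerAlgebra (rayClassField_mul_pow_succ_le_of_le h𝔣' hle m)) (b.val m)
  ne_zero m := by
    rw [coe_towerNorm_eq_prod_smul, Finset.prod_ne_zero_iff]
    intro σ _
    rw [absoluteGaloisGroup.smul_def]
    exact (EmbeddingLike.map_ne_zero_iff).mpr (b.ne_zero m)
  isIntegral m := by
    rw [coe_towerNorm_eq_prod_smul]
    refine IsIntegral.prod _ fun σ _ ↦ ?_
    rw [absoluteGaloisGroup.smul_def]
    exact isIntegral_int_map_ringHom₁₄ (absoluteGaloisGroup.toAlgEquiv K _ : AlgebraicClosure K →+* AlgebraicClosure K)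
      (b.isIntegral m)
  isIntegral_inv m := by
    rw [coe_towerNorm_eq_prod_smul, ← Finset.prod_inv_distrib]
    refine IsIntegral.prod _ fun σ _ ↦ ?_
    rw [absoluteGaloisGroup.smul_def, ← map_inv₀]
    exact isIntegral_int_map_ringHom₁₄ (absoluteGaloisGroup.toAlgEquiv K _ : AlgebraicClosure K →+* AlgebraicClosure K)
      (b.isIntegral_inv m)
  coherent n m hnm := by
    -- `N_{L_m/L_n} (N_{L′_m/L_m} b′_m) = N_{L′_m/L_n} b′_m = N_{L′_n/L_n} (N_{L′_m/L′_n} b′_m) = N_{L′_n/L_n} b′_n`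
    rw [towerNorm_towerNorm₁₄ (rayClassField_mul_pow_succ_mono h𝔣 v hnm) (rayClassField_mul_pow_succ_le_of_le h𝔣' hle m),
      ← towerNorm_towerNorm₁₄ (rayClassField_mul_pow_succ_le_of_le h𝔣' hle n) (rayClassField_mul_pow_succ_mono h𝔣' v hnm)]
    have hc : @Algebra.norm (rayClassField K (𝔣' * v.asIdeal ^ (n + 1))) (rayClassField K (𝔣' * v.asIdeal ^ (m + 1))) _ _
        (towerAlgebra (rayClassField_mul_pow_succ_mono h𝔣' v hnm)) (b.val m) = b.val n :=
      Subtype.ext (b.coherent n m hnm)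
    rw [hc]

/-- Components of the relative norm (unfolding). [cite: deShalit1987, III.1.2 Lemma (ii) (p. 89)] -/
theorem val_relNorm (hle : 𝔣' ≤ 𝔣) (b : GlobalNormCoherentUnits h𝔣' v) (m : ℕ) :
    (relNorm h𝔣 h𝔣' hle b).val m =
      @Algebra.norm (rayClassField K (𝔣 * v.asIdeal ^ (m + 1))) (rayClassField K (𝔣' * v.asIdeal ^ (m + 1))) _ _
        (towerAlgebra (rayClassField_mul_pow_succ_le_of_le h𝔣' hle m)) (b.val m) := rfl

/-! ### §2. `N_{𝔣′,𝔣} = ∏_{τ ∈ T} τ` for a transversal `T` inside `Gal(K̄/K(𝔣v^∞))` -/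

attribute [local instance] instCommMonoid galAction

/-- Components of a finite product in the monoid of global unit sequences, in `K̄`. [cite: deShalit1987, II.4.9 (24) (p. 62)] -/
theorem coe_val_finset_prod {ι : Type*} (s : Finset ι) (f : ι → GlobalNormCoherentUnits h𝔣' v) (m : ℕ) :
    (((∏ i ∈ s, f i).val m : rayClassField K (𝔣' * v.asIdeal ^ (m + 1))) : AlgebraicClosure K) =
      ∏ i ∈ s, (((f i).val m : rayClassField K (𝔣' * v.asIdeal ^ (m + 1))) : AlgebraicClosure K) := by
  induction s using Finset.induction_on with
  | empty => rw [Finset.prod_empty, Finset.prod_empty, coe_val_one]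
  | insert i s hi ih => rw [Finset.prod_insert hi, Finset.prod_insert hi, coe_val_mul, ih]

variable [IsTotallyComplex K] (hle : 𝔣' ≤ 𝔣) (hv' : ¬ 𝔣' ≤ v.asIdeal) (hw : ∀ u : (𝓞 K)ˣ, (u : 𝓞 K) - 1 ∈ 𝔣 → u = 1)
  {T : Finset (absoluteGaloisGroup K)} (hT : ∀ τ ∈ T, ∀ n, τ ∈ (absRayAdicTower h𝔣 v).U n)
  (hcov : ∀ h ∈ (absRestrictNormalHom (rayClassField K 𝔣)).ker, ∃ τ ∈ T,
    h⁻¹ * τ ∈ (absRestrictNormalHom (rayClassField K 𝔣')).ker)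
  (hinj : ∀ τ₁ ∈ T, ∀ τ₂ ∈ T, τ₁⁻¹ * τ₂ ∈ (absRestrictNormalHom (rayClassField K 𝔣')).ker → τ₁ = τ₂)

include hle hv' hw hT hcov hinj in
/-- ★ **`(∏_{τ ∈ T} τ • b′)_m = (N_{𝔣′,𝔣} b′)_m` in `K̄`**: for a transversal `T ⊆ Gal(K̄/K(𝔣v^∞))` of `Gal(K(𝔣′)/K(𝔣))`, the
product of the `τ`-conjugates of `b′` in the `Γ_K`-monoid of modulus `𝔣′` has, at every level, the value of the relative norm
(`prod_rayTransversal_smul_eq_coe_towerNorm` at level `m`). [cite: deShalit1987, III.1.2 Lemma (ii) (p. 89), II.2.5 (i) (p. 47)] -/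
theorem coe_val_finset_prod_smul_eq_relNorm (b : GlobalNormCoherentUnits h𝔣' v) (m : ℕ) :
    (((∏ τ ∈ T, τ • b).val m : rayClassField K (𝔣' * v.asIdeal ^ (m + 1))) : AlgebraicClosure K) =
      (((relNorm h𝔣 h𝔣' hle b).val m : rayClassField K (𝔣 * v.asIdeal ^ (m + 1))) : AlgebraicClosure K) := by
  rw [coe_val_finset_prod, val_relNorm]
  simp_rw [coe_val_smul]
  exact prod_rayTransversal_smul_eq_coe_towerNorm h𝔣 h𝔣' v hle hv' hw hT hcov hinj m (b.val m)

include hle hv' hw hT hcov hinj in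
/-- The same with a further `γ ∈ Γ_K` in front: `(γ • ∏_{τ ∈ T} τ • b′)_m = γ • (N_{𝔣′,𝔣} b′)_m` in `K̄` — the link
`i′(γ • ∏ τ•b′)` vs `i(γ • N b′)` of `GroupDistribution.pushforward_induceFrom_μ_eq_induceFrom_of_norm` reads the SAME elements.
[cite: deShalit1987, III.1.2 Lemma (ii) (p. 89)] -/
theorem coe_val_smul_finset_prod_smul_eq (γ : absoluteGaloisGroup K) (b : GlobalNormCoherentUnits h𝔣' v) (m : ℕ) :
    (((γ • ∏ τ ∈ T, τ • b).val m : rayClassField K (𝔣' * v.asIdeal ^ (m + 1))) : AlgebraicClosure K) =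
      (((γ • relNorm h𝔣 h𝔣' hle b).val m : rayClassField K (𝔣 * v.asIdeal ^ (m + 1))) : AlgebraicClosure K) := by
  rw [coe_val_smul, coe_val_smul, coe_val_finset_prod_smul_eq_relNorm h𝔣 h𝔣' hle hv' hw hT hcov hinj]

end GlobalNormCoherentUnits

end Literature.NumberTheory.NumberFields

end
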